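import HarnessLib
import Summits.Langlands.Langlands.Theses.QuarterDeficit1951

/-!
# Disproof of `QuarterFingerprintDeficit` — findings (cycle 1, 2026-08-16)

Crux C1 = `Summit.Langlands.Langlands.Theses.QuarterDeficit1951.QuarterFingerprintDeficit`
(item `stmt-Langlands-15897`, route `route-Langlands-QuarterDeficit1951`, rank 2, computational bet):
for EVERY Dirichlet character `χ mod 1951` of order `5` there is NO `(u, λ)` with `u : ℍ → ℂ` bounded,
`C²`, `Γ₀(1951)`-automorphic with nebentypus `χ(d)`, `Δu + λu = 0` (Iwaniec sign), zero constant terms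
at the two cusps `∞`, `0`, `u ≢ 0`, `|λ − 1/4| ≤ 1/100`, and a joint `T_p`-eigenfunction (`p ≤ 13`,
unitary normalisation) whose eigenvalues satisfy `‖μ_p² χ̄(p) − φ_p‖ ≤ 1/100`, `φ_p ∈ Φ = {0,1,4,(3±√5)/2}`.

## Verdict of this cycle: NOT KILLED — and why it resists

`¬ C1` is LITERALLY a sighting (`not_deficit_iff_windowSighting`): an order-5 `χ` and a nonzero
bounded cuspidal Maass eigenform on `(Γ₀(1951), χ)` in the window with the approximate fingerprint.
Every hypothesis of `IsForm` was audited symbol by symbol (see §0) and found faithful — there is no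
junk inhabitant: `UpperHalfPlane.ofComplex` is only ever evaluated at points of positive imaginary
part (`x + iy` with `y > 0`, `(z + b)/p`, `p z`), the Laplacian carries Iwaniec's sign so `λ ≈ 1/4`
is the tempered bottom of the cuspidal spectrum (not the empty negative half-line), `−I ∈ Γ₀(1951)`
is harmless because order-5 characters are even (§1), both constant-term conditions have the right
periods (`1` at `∞`; `1951` at `0`, since `[[1,0],[−1951,1]] ∈ Γ₀(1951)` has `d = 1`), and
"bounded + zero constant terms + eigenfunction" forces the `√y K_{ir}(2π|n|y)` Fourier expansion at
both cusps, i.e. a genuine Maass cusp NEWform (cond `χ = 1951` = level, so no oldforms). Hence a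
witness for `¬ C1` must be an honest Maass cusp form, and:

* the INTENDED violators are the weight-0, `λ = 1/4` newforms attached by Langlands reciprocity to the
  four Doud–Moore even icosahedral Artin representations of conductor `1951` (quintic
  `x⁵ − x⁴ − 780x³ − 1795x² + 3106x + 344`, totally real, `A₅`, `d_K = 1951⁴`; Frobenius types and
  the predicted fingerprint at `p ≤ 13` in §4) — their existence is the EVEN icosahedral case of the strong
  Artin conjecture, OPEN (Booker–Lee–Strömbergsson 2020 Thm 2 is conditional on Artin; BLS §1:
  the unconditional computation "has not yet been carried out"); no theorem in print gives them;
* an ACCIDENTAL violator (a generic window form whose six `|μ_p|²` all fall within `1/100` of `Φ`)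
  has heuristic probability `≈ 4·10⁻⁶` (Sato–Tate mass of the `1/100`-neighbourhood of `Φ` is
  `≈ 0.08` per prime, dominated by `|a_p|² ≤ 1/100`; `0.08⁶ ≈ 3·10⁻⁷`; Weyl law
  `N(λ) ≈ (1952·π/3)/(4π)·λ ≈ 163 λ` gives `≈ 3` window forms per character, `4` characters) and
  could in any case only be exhibited by certified numerics;
* Mathlib has NO existence theory for Maass cusp forms whatsoever (no `K`-Bessel/Whittaker
  functions, no spectral theorem for `L²(Γ\ℍ)`, no Selberg trace formula, no Maass theta lift from
  real quadratic fields), so not even a dihedral `λ = 1/4` form on some other `(N, χ)` is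
  constructible in-kernel today. A certified sighting (Hejhal at `r = 0` + Booker–Strömbergsson–
  Venkatesh / Child 2022 quasimode certification, the lead's PICKED line) would refute C1 in the
  verdict class `computation`, not as a kernel proof of `¬ C1`.

So no `…Refutation.lean` can be landed this cycle; what IS landed is the load-bearing analysis below.

## Barrier reduction and prior art (searched 2026-08-16)

* `Literature.Barriers.Langlands.NonRegularWeightBarrier` bites the DISPROOF direction, not the
  route: the intended violator is an automorphic form of the singular archimedean type `(0,0)`
  (`maassQuarterInfinityType`, proved there non-regular), for an EVEN `A₅` representation — Calegari
  (ICM 2022 §12, quoted in the barrier file): "we do not even know how to prove that there exists a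
  corresponding Maass form with the right Laplacian eigenvalue". Every modularity-lifting /
  potential-automorphy engine in the tree needs regular weight or oddness; Langlands–Tunnell covers
  only solvable image (`SolvableImageBarrier`). Hence no printed theorem yields `ExactSighting`.
* Booker, Exp. Math. 15 (2006) = arXiv:math/0507502, p. 3: for even 2-dimensional representations
  "the conjecture has been established for all but the icosahedral cases ... computation of the
  associated forms remains elusive; existing techniques (see e.g. [BSV]) only allow one to calculate
  Maass forms to within a prescribed precision, never exactly. Thus, at present this approach does
  not yield an algorithm for verifying Artin's conjecture"; p. 8: his group-theoretic holomorphy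
  criterion "does not apply to checking the icosahedral case", and "totally real `A₅` fields ... are
  very rare; the smallest known discriminant is far too large to test with current computers".
* Booker–Lee–Strömbergsson, JLMS 2020 = arXiv:1803.06016, Thm 2 (p. 3): conditional on Artin the
  even non-dihedral 2-dimensional Artin representations of conductor `≤ 2862` are classified, the
  first icosahedral one at `N = 1951` (Doud–Moore); p. 3: the unconditional computation "has not yet
  been carried out"; §1.1 (p. 4) fixes exactly the crux's conventions (`f(γz) = χ(d) f(z)`,
  `T_n f = |n|^{-1/2} Σ_{ad=n} χ(a) Σ_{b mod d} f((az+b)/d)`, `T_n f = a_f(n) f`).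
* `ledger negatives --problem Langlands`: one entry (K3KugaSatake `SerreTypeAnchor`, a typing kill),
  unrelated. No refutation of any Maass-form statement in `Theorems/*Refutation.lean`.

Conclusion: the only live route to `¬ C1` is a CERTIFIED NUMERICAL sighting (verdict class
`computation`), which is precisely the lead's picked line; a kernel term of type
`¬ QuarterFingerprintDeficit` is out of reach of the current tree in either outcome.

## Contents
* §0 `deficit_iff`, `not_deficit_iff_windowSighting` — the crux restated over NAMED predicates
  (`Φ`, `P₀`, `IsForm`, `Tp`, `WindowSighting`) by `Iff.rfl`: the lead's kit sighting must produce
  exactly a `WindowSighting`.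
* §1 non-vacuity / parity regime: `exists_orderOf_eq_five` (the `∀ χ` ranges over a non-empty set:
  `#DirichletCharacter ℂ 1951 = φ(1951) = 1950`, Cauchy), `apply_neg_one_eq_one_of_orderOf_eq_five`
  (order-5 characters are even), `form_eq_zero_of_apply_neg_one` (for an ODD character the automorphy
  clause alone forces `u ≡ 0` via `−I`, so the analogous deficit statement would be vacuously true —
  the order-5 hypothesis keeps C1 out of that regime).
* §2 load-bearing hypotheses: `QuarterFingerprintDeficitWithoutNonzero` /
  `quarterFingerprintDeficit_false_without_nonzero` (drop `∃ z, u z ≠ 0` ⇒ FALSE, witness `u = 0`,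
  `λ = 1/4`, `μ_p = 0`, `φ = 0`) — LANDING as
  `Theorems/QuarterFingerprintDeficit/Negative/FalseWithoutNonzero.lean`. Table of the other
  hypotheses (docstring of §2): each is structurally load-bearing, none has an in-kernel witness.
* §3 `ExactSighting` (the conclusion shape of the sibling crux `CorrespondentFingerprint`: `λ = 1/4`
  and `μ_p² χ̄(p) ∈ Φ` exactly) and `quarterFingerprintDeficit_false_of_exactSighting` — the modus
  tollens the assembly `closes` runs; recorded so that "Artin for Doud–Moore ⇒ ¬C1" is by name.
* §4 the predicted violator's fingerprint (kit `j020325`), fingerprint non-separation remark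
  (`tetrahedral_values_subset_Φ`): `Φ ⊇ {0,1,4}` = the `A₄`/`D₃`/`D₂` value set, so the six-prime
  fingerprint does not by itself single out icosahedral forms — what isolates the icosahedral
  prediction is `orderOf χ = 5` at PRIME level 1951 (tetrahedral/octahedral lifts of conductor 1951
  have `det` of order 2, 3, 4; dihedral reps of conductor 1951 are induced from `ℚ(√−1951)`, odd).
* §5 statement-level notes for the planner (no action needed): the thesis prose says "for SOME
  order-5 χ no form", the decl says `∀ χ`; the assembly needs `∀` (C2a yields an unspecified χ), so a
  TRUE-certificate must clear all four characters. The window `[0.24, 0.25)` is not excluded by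
  Kim–Sarnak (`λ₁ ≥ 975/4096 ≈ 0.238`) nor by BLS Thm 1 (Selberg verified for `Γ₁(N)`, `N ≤ 880`
  only), so the census must genuinely cover exceptional eigenvalues too.

No statement of the route is asserted positively. [folklore]
-/

set_option linter.dupNamespace false -- project-wide option; `Summit.Langlands.Langlands` is the mandated namespace

noncomputable section

open Summit.Langlands.Langlands.Theses.QuarterDeficit1951

namespace Summit.Langlands.Langlands.Cruxes.QuarterFingerprintDeficit.Disproof

/-! ## §0 The crux over named predicates -/

/-- The projective fingerprint set `Φ = {tr(g)²/det(g) : g of order 1, 2, 3, 5} = {4, 0, 1, (3 ± √5)/2}`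
(for `g` with eigenvalue ratio a primitive `m`-th root of unity `ζ`, `tr²/det = ζ + ζ⁻¹ + 2`). [folklore] -/
def Φ : Set ℂ := {0, 1, 4, (((3 + Real.sqrt 5) / 2 : ℝ) : ℂ), (((3 - Real.sqrt 5) / 2 : ℝ) : ℂ)}

/-- The six test primes of the crux. [folklore] -/
def P₀ : Finset ℕ := {2, 3, 5, 7, 11, 13}

/-- `IsForm χ u λ` — the crux's inlined predicate "`u` is a bounded `C²` solution of `Δu + λu = 0`,
`Γ₀(1951)`-automorphic with nebentypus `χ(d)`, with vanishing constant terms at `∞` (width 1) and at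
`0` (period 1951 in the coordinate `z ↦ S•z`)". Copied verbatim from the route file. [folklore] -/
def IsForm (χ : DirichletCharacter ℂ 1951) (u : UpperHalfPlane → ℂ) (lam : ℝ) : Prop :=
  Literature.NumberTheory.Automorphic.IsC2 u ∧
  (∀ z, Literature.NumberTheory.Automorphic.hypLaplacian u z + (lam : ℂ) * u z = 0) ∧
  (∀ γ : Matrix.SpecialLinearGroup (Fin 2) ℤ, γ ∈ CongruenceSubgroup.Gamma0 1951 →
    ∀ z : UpperHalfPlane, u (γ • z) = χ ((γ 1 1 : ℤ) : ZMod 1951) * u z) ∧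
  (∀ y : ℝ, 0 < y → ∫ x in (0 : ℝ)..1, u (UpperHalfPlane.ofComplex (x + y * Complex.I)) = 0) ∧
  (∀ y : ℝ, 0 < y →
    ∫ x in (0 : ℝ)..1951, u (ModularGroup.S • UpperHalfPlane.ofComplex (x + y * Complex.I)) = 0) ∧
  (∃ C : ℝ, ∀ z, ‖u z‖ ≤ C)

/-- The crux's classical Hecke operator, unitary normalisation with nebentypus:
`T_p u (z) = p^{-1/2} (Σ_{b mod p} u((z+b)/p) + χ(p) u(pz))` — this is Booker–Lee–Strömbergsson
2020 §1.1, `T_n f = |n|^{-1/2} Σ_{ad=n} χ(a) Σ_{b mod d} f((az+b)/d)` at `n = p`, for which a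
normalised Hecke eigenform has `T_p f = a_f(p) f` (Ramanujan scale `|a_f(p)| ≤ 2`). [folklore] -/
def Tp (χ : DirichletCharacter ℂ 1951) (p : ℕ) (u : UpperHalfPlane → ℂ) (z : UpperHalfPlane) : ℂ :=
  ((Real.sqrt p : ℝ) : ℂ)⁻¹ *
    ((∑ b ∈ Finset.range p, u (UpperHalfPlane.ofComplex (((z : ℂ) + b) / p))) +
      χ (p : ZMod 1951) * u (UpperHalfPlane.ofComplex ((p : ℂ) * z)))

/-- A WINDOW SIGHTING — the literal content of `¬ QuarterFingerprintDeficit`: an order-5 character and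
a nonzero form in the window `|λ − 1/4| ≤ 1/100` with the fingerprint to tolerance `1/100` at the six
primes. This is exactly what the lead's kit job (Hejhal at `r = 0` + quasimode certification) has to
certify; it is a `computation`-class object, not constructible in-kernel today. [folklore] -/
def WindowSighting : Prop :=
  ∃ χ : DirichletCharacter ℂ 1951, orderOf χ = 5 ∧ ∃ (u : UpperHalfPlane → ℂ) (lam : ℝ),
    IsForm χ u lam ∧ (∃ z, u z ≠ 0) ∧ |lam - 1 / 4| ≤ 1 / 100 ∧
    ∀ p ∈ P₀, ∃ μ φ : ℂ, φ ∈ Φ ∧ (∀ z, Tp χ p u z = μ * u z) ∧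
      ‖μ ^ 2 * (starRingEnd ℂ) (χ (p : ZMod 1951)) - φ‖ ≤ 1 / 100

/-- The crux unfolded over the named predicates (definitional: `Iff.rfl`). [folklore] -/
theorem deficit_iff : QuarterFingerprintDeficit ↔
    ∀ χ : DirichletCharacter ℂ 1951, orderOf χ = 5 → ¬ ∃ (u : UpperHalfPlane → ℂ) (lam : ℝ),
    IsForm χ u lam ∧ (∃ z, u z ≠ 0) ∧ |lam - 1 / 4| ≤ 1 / 100 ∧
    ∀ p ∈ P₀, ∃ μ φ : ℂ, φ ∈ Φ ∧ (∀ z, Tp χ p u z = μ * u z) ∧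
      ‖μ ^ 2 * (starRingEnd ℂ) (χ (p : ZMod 1951)) - φ‖ ≤ 1 / 100 := Iff.rfl

/-- **`¬ C1` is a window sighting, no more and no less.** [folklore] -/
theorem not_deficit_iff_windowSighting : ¬ QuarterFingerprintDeficit ↔ WindowSighting := by
  rw [deficit_iff, WindowSighting]
  push Not
  rfl

/-! ## §1 Non-vacuity and the parity regime -/

/-- **The `∀ χ` of the crux is not vacuous**: there is a Dirichlet character mod `1951` of order `5`
(`1951` is prime, `#(ℤ/1951)ˣ = 1950 = 2·3·5²·13`, `ℂ` has enough roots of unity, Cauchy). [folklore] -/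
theorem exists_orderOf_eq_five : ∃ χ : DirichletCharacter ℂ 1951, orderOf χ = 5 := by
  haveI : Fact (Nat.Prime 1951) := ⟨by norm_num⟩
  haveI : NeZero ((Monoid.exponent (ZMod 1951)ˣ : ℕ) : ℂ) :=
    ⟨by exact_mod_cast Monoid.exponent_ne_zero.mpr Monoid.ExponentExists.of_finite⟩
  have h1 : Nat.card (DirichletCharacter ℂ 1951) = 1950 := by
    rw [DirichletCharacter, MulChar.card_eq_card_units_of_hasEnoughRootsOfUnity (ZMod 1951) ℂ,
      Nat.card_eq_fintype_card, ZMod.card_units]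
  haveI : Fact (Nat.Prime 5) := ⟨by norm_num⟩
  exact exists_prime_orderOf_dvd_card' (G := DirichletCharacter ℂ 1951) 5 (by rw [h1]; norm_num)

/-- **Order-5 characters are even** (`χ(−1)² = 1` and `χ(−1)⁵ = 1`), so the automorphy clause at
`γ = −I ∈ Γ₀(1951)` (`u z = χ(−1) u z`) is no hidden constraint. [folklore] -/
theorem apply_neg_one_eq_one_of_orderOf_eq_five (χ : DirichletCharacter ℂ 1951) (h : orderOf χ = 5) :
    χ (-1) = 1 := by
  have hsq : χ (-1) * χ (-1) = 1 := by rw [← map_mul, neg_one_mul, neg_neg, map_one]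
  rcases mul_self_eq_one_iff.mp hsq with h1 | h1
  · exact h1
  · exfalso
    have h' : (χ (-1)) ^ orderOf χ = 1 := by
      have hu : IsUnit (-1 : ZMod 1951) := isUnit_one.neg
      obtain ⟨u, hu'⟩ := hu
      have := congr_arg (fun φ : DirichletCharacter ℂ 1951 => φ (u : ZMod 1951)) (pow_orderOf_eq_one χ)
      simp only [MulChar.pow_apply_coe, MulChar.one_apply_coe] at this
      rwa [hu'] at this
    rw [h1, h] at h'
    norm_num at h'

/-- **The parity regime the crux avoids.** For an ODD character the automorphy clause of `IsForm`
alone forces `u ≡ 0` (apply it to `γ = −I ∈ Γ₀(1951)`, which acts trivially on `ℍ` and has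
`d = −1`): the analogue of C1 for odd characters is vacuously TRUE. By
`apply_neg_one_eq_one_of_orderOf_eq_five` the order-5 hypothesis keeps C1 out of this regime, so C1 is
a genuine census statement. [folklore] -/
theorem form_eq_zero_of_apply_neg_one (χ : DirichletCharacter ℂ 1951) (hodd : χ (-1) = -1)
    (u : UpperHalfPlane → ℂ)
    (hu : ∀ γ : Matrix.SpecialLinearGroup (Fin 2) ℤ, γ ∈ CongruenceSubgroup.Gamma0 1951 →
      ∀ z : UpperHalfPlane, u (γ • z) = χ ((γ 1 1 : ℤ) : ZMod 1951) * u z) :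
    ∀ z, u z = 0 := by
  intro z
  have hmem : (-1 : Matrix.SpecialLinearGroup (Fin 2) ℤ) ∈ CongruenceSubgroup.Gamma0 1951 := by
    rw [CongruenceSubgroup.Gamma0_mem]; simp
  have h := hu (-1) hmem z
  have e1 : ((-1 : Matrix.SpecialLinearGroup (Fin 2) ℤ) • z) = z := by
    rw [ModularGroup.SL_neg_smul, one_smul]
  have e2 : (((-1 : Matrix.SpecialLinearGroup (Fin 2) ℤ) 1 1 : ℤ) : ZMod 1951) = -1 := by simp
  rw [e1, e2, hodd] at h
  have : (2 : ℂ) * u z = 0 := by linear_combination h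
  simpa using this

/-! ## §2 Load-bearing hypotheses

| hypothesis dropped from C1 | status | witness / obstruction |
|---|---|---|
| `∃ z, u z ≠ 0` | FALSE without it — `quarterFingerprintDeficit_false_without_nonzero` | `u = 0`, `λ = 1/4`, `μ_p = 0`, `φ = 0` |
| `|λ − 1/4| ≤ 1/100` | no in-kernel witness | needs SOME Maass cusp form on `(Γ₀(1951), χ)`; none constructible |
| constant terms `= 0` + bounded | no in-kernel witness | Eisenstein series `E(z, s, χ)` at `s(1−s) ≈ 1/4` needs analytic continuation to `Re s = 1/2` |
| bounded only | no in-kernel witness | would need an `I`-Bessel / Poincaré-type automorphic eigenfunction |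
| automorphy | no in-kernel witness | free eigenfunctions `√y K_{ir}(2π|n|y) e(nx)` are bounded with zero mean but `K`-Bessel is not in Mathlib; `y^s` is unbounded; AND the `T_p`-clause with `Σ_b e(b/p) = 0` kills single exponentials |
| `T_p` / fingerprint clause | no in-kernel witness | "no window form at all on `(Γ₀(1951), χ)`" is false in reality (Weyl: ≈ 3 per character) but unprovable here |
| `orderOf χ = 5` (→ any χ) | no in-kernel witness | at prime level 1951 there are no even dihedral forms for ANY character (`1951 ≡ 3 mod 4`); tetrahedral/octahedral conductor-1951 lifts would have `det` of order 2, 3, 4 — none constructible anyway |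
| `IsC2` | irrelevant | without `C²` Mathlib's `Δ` is junk `0`, and `λ u = 0` forces `u = 0`: no new witness |
-/

/-- C1 with the nontriviality clause `∃ z, u z ≠ 0` DROPPED (everything else verbatim). [folklore] -/
def QuarterFingerprintDeficitWithoutNonzero : Prop :=
  ∀ χ : DirichletCharacter ℂ 1951, orderOf χ = 5 → ¬ ∃ (u : UpperHalfPlane → ℂ) (lam : ℝ),
    IsForm χ u lam ∧ |lam - 1 / 4| ≤ 1 / 100 ∧
    ∀ p ∈ P₀, ∃ μ φ : ℂ, φ ∈ Φ ∧ (∀ z, Tp χ p u z = μ * u z) ∧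
      ‖μ ^ 2 * (starRingEnd ℂ) (χ (p : ZMod 1951)) - φ‖ ≤ 1 / 100

/-- **Nontriviality is load-bearing**: without `∃ z, u z ≠ 0` the crux is FALSE — the zero function is
a bounded `C²` cuspidal "form" of every eigenvalue and every Hecke eigenvalue (`u = 0`, `λ = 1/4`,
`μ_p = 0`, `φ_p = 0 ∈ Φ`), for the order-5 character supplied by `exists_orderOf_eq_five`. [folklore] -/
theorem quarterFingerprintDeficit_false_without_nonzero : ¬ QuarterFingerprintDeficitWithoutNonzero := by
  intro h
  obtain ⟨χ, hχ⟩ := exists_orderOf_eq_five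
  apply h χ hχ
  refine ⟨fun _ => 0, 1 / 4, ?_, by norm_num, ?_⟩
  · exact ⟨Literature.NumberTheory.Automorphic.isC2_const 0, fun z => by simp, fun γ _ z => by simp,
      fun y _ => by simp, fun y _ => by simp, ⟨0, fun z => by simp⟩⟩
  · intro p _
    exact ⟨0, 0, by simp [Φ], fun z => by simp [Tp], by simp⟩

/-- Sanity: C1 is exactly "`QuarterFingerprintDeficitWithoutNonzero` restricted to nonzero `u`",
i.e. the only difference between the refuted variant and the crux is the clause `∃ z, u z ≠ 0`. [folklore] -/
theorem deficit_iff_withoutNonzero_restricted : QuarterFingerprintDeficit ↔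
    ∀ χ : DirichletCharacter ℂ 1951, orderOf χ = 5 → ∀ (u : UpperHalfPlane → ℂ) (lam : ℝ),
      (∃ z, u z ≠ 0) → ¬ (IsForm χ u lam ∧ |lam - 1 / 4| ≤ 1 / 100 ∧
        ∀ p ∈ P₀, ∃ μ φ : ℂ, φ ∈ Φ ∧ (∀ z, Tp χ p u z = μ * u z) ∧
          ‖μ ^ 2 * (starRingEnd ℂ) (χ (p : ZMod 1951)) - φ‖ ≤ 1 / 100) := by
  rw [deficit_iff]
  refine forall₂_congr fun χ _ => ?_
  constructor
  · rintro h u lam hne ⟨hf, hl, hp⟩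
    exact h ⟨u, lam, hf, hne, hl, hp⟩
  · rintro h ⟨u, lam, hf, hne, hl, hp⟩
    exact h u lam hne ⟨hf, hl, hp⟩

/-! ## §3 The exact sighting (what Langlands reciprocity predicts) -/

/-- An EXACT sighting: an order-5 `χ` and a nonzero `λ = 1/4` form whose six `μ_p² χ̄(p)` lie IN `Φ`.
This is the conclusion shape of the sibling crux `CorrespondentFingerprint` (C2a) once a correspondent
`π` of a Doud–Moore representation is supplied by conjunct (B) of the summit; informally it is "the
even icosahedral Maass newform of level 1951 exists" — the open even case of strong Artin. [folklore] -/
def ExactSighting : Prop :=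
  ∃ χ : DirichletCharacter ℂ 1951, orderOf χ = 5 ∧ ∃ u : UpperHalfPlane → ℂ,
    IsForm χ u (1 / 4) ∧ (∃ z, u z ≠ 0) ∧
    ∀ p ∈ P₀, ∃ μ φ : ℂ, φ ∈ Φ ∧ (∀ z, Tp χ p u z = μ * u z) ∧
      μ ^ 2 * (starRingEnd ℂ) (χ (p : ZMod 1951)) = φ

/-- An exact sighting is a window sighting (`λ = 1/4` is in the window, distance `0 ≤ 1/100`). [folklore] -/
theorem windowSighting_of_exactSighting (h : ExactSighting) : WindowSighting := by
  obtain ⟨χ, hχ, u, hform, hne, hfp⟩ := h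
  refine ⟨χ, hχ, u, 1 / 4, hform, hne, by norm_num, fun p hp => ?_⟩
  obtain ⟨μ, φ, hφ, hT, hμ⟩ := hfp p hp
  exact ⟨μ, φ, hφ, hT, by rw [hμ, sub_self, norm_zero]; norm_num⟩

/-- **Artin for Doud–Moore ⇒ ¬C1, by name**: an exact sighting refutes the crux (the modus tollens that
the route's `closes` runs in the other direction). NOT filed as a negative lemma modulo
`ExactSighting`: that hypothesis is not a missing tree construction but the open mathematical heart
(even icosahedral Artin), so holding the item on it would be vacuous bookkeeping. [folklore] -/
theorem quarterFingerprintDeficit_false_of_exactSighting (h : ExactSighting) :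
    ¬ QuarterFingerprintDeficit :=
  not_deficit_iff_windowSighting.mpr (windowSighting_of_exactSighting h)

/-! ## §4 The predicted violator and what the fingerprint does (not) separate

Doud–Moore (J. Number Theory 118 (2006)): `f = x⁵ − x⁴ − 780x³ − 1795x² + 3106x + 344`.
Checked here (python, exact arithmetic; PARI kit job `j020325` for `d_K`, `p = 2, 7` and `p ≤ 200`):
`disc f = (2·7·71·137)² · 1951⁴`, five real roots (`−26.09, −3.48, −0.10, 1.23, 29.44`), `f`
irreducible mod 3, Frobenius cycle types `(5)` at `p = 3, 11`, `(2,2,1)` at `p = 5`, `(3,1,1)` at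
`p = 13` (so the Galois group, inside `A₅` by the square discriminant, contains a 3-cycle and is
transitive: it is `A₅`); at the index primes `f ≡ x²(x³+x²+1) (mod 2)` and
`f ≡ (x+4)²(x+6)(x²+6x+3) (mod 7)`, whose squarefree parts already force the `A₅`-types `(3,1,1)` at
`2` and `(2,2,1)` at `7` (the only even cycle types containing a 3-cycle, resp. a 2-cycle), and `2, 7`
ARE unramified: the Dedekind criterion (exact integer arithmetic, evidence file `dm1951_fieldcheck.md`)
shows `ℤ[α]` is non-maximal at each of `2, 7, 71, 137` (so each divides the index exactly once and
`v_p(d_K) = 0` there) and maximal at `1951`, where `f ≡ (x − 1561)⁵` and `1951² ∤ f(1561)`: hence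
`d_K = 1951⁴` EXACTLY, `1951 = 𝔭⁵` tamely and totally ramified (inertia a 5-cycle ⇒ minimal lifts have
conductor `1951` and determinant of order exactly `5` — the route's order-5 bookkeeping is confirmed),
and `K` is unramified outside `1951`. PARI cross-check, kit job `j020504` (summary attached to the
item): `polisirreducible = 1`, `polgalois = [60, 1, 1, "A5"]`, `nfdisc = 1951⁴`, signature `(5, 0)`,
index `136178 = 2·7·71·137`, `idealprimedec(1951) = [e, f] = [5, 1]`, residue degrees `[3,1,1], [5],
[2,2,1], [2,2,1], [5], [3,1,1]` at `p = 2, 3, 5, 7, 11, 13`, no ramified `p ≤ 200` other than `1951`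
(`polredabs` form: `x⁵ − x⁴ − 780x³ + 9911x² − 24208x + 15952`). Predicted
fingerprint of the violating newform (any of the four lifts / conjugates; `|μ_p|² = tr²/det` depends
only on the order of `Frob_p` in `A₅`):

| `p` | 2 | 3 | 5 | 7 | 11 | 13 |
|---|---|---|---|---|---|---|
| type of `Frob_p` | (3,1,1) | (5) | (2,2,1) | (2,2,1) | (5) | (3,1,1) |
| `|μ_p|²` | 1 | (3±√5)/2 | 0 | 0 | (3±√5)/2 | 1 |

(so `μ_5 = μ_7 = 0` exactly for the predicted forms). For a newform on `(Γ₀(N), χ)` one has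
`ā_p = χ̄(p) a_p` (`p ∤ N`), so the crux's `μ_p² χ̄(p)` IS `|μ_p|² ≥ 0` — the fingerprint test is a
test on six real numbers, and the `±√5` ambiguity (classes `5A/5B`, swapped by the outer automorphism
and by `√5 ↦ −√5`) is immaterial because both values lie in `Φ`.
-/

/-- **The fingerprint does not single out `A₅`.** `Φ ⊇ {0, 1, 4}` — the full value set `tr²/det` of
a projectively TETRAHEDRAL (`A₄`: element orders 1, 2, 3) representation, and of dihedral `D₂`, `D₃`
(and `D₅ ⊆ A₅` gives all of `Φ`). What isolates the icosahedral prediction inside C1 is therefore not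
`Φ` but `orderOf χ = 5` at PRIME level: a conductor-1951 lift `ρ` has `ρ|_{I₁₉₅₁} = 1 ⊕ η` with
`ord(det ρ) = ord(η)` = the order of projective inertia `∈ {2,3}` (A₄), `{2,3,4}` (S₄), `{2,3,5}` (A₅),
and dihedral conductor-1951 representations are induced from `ℚ(√−1951)` (odd, weight 1). [folklore] -/
theorem tetrahedral_values_subset_Φ : ({0, 1, 4} : Set ℂ) ⊆ Φ := by
  intro x hx
  simp only [Set.mem_insert_iff, Set.mem_singleton_iff] at hx
  rcases hx with rfl | rfl | rfl <;> simp [Φ]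

/-- The two icosahedral values are the two roots of `x² − 3x + 1` (`= ζ₅ + ζ₅⁻¹ + 2` and
`ζ₅² + ζ₅⁻² + 2`), matching the `t⁴ − 3 d t² + d² = 0` clause of `IcosahedralSupply` /
`CorrespondentFingerprint` (divide by `d²`, `x = t²/d`). [folklore] -/
theorem icosahedral_values_are_roots :
    ∀ x ∈ ({(((3 + Real.sqrt 5) / 2 : ℝ) : ℂ), (((3 - Real.sqrt 5) / 2 : ℝ) : ℂ)} : Set ℂ),
      x ^ 2 - 3 * x + 1 = 0 := by
  intro x hx
  simp only [Set.mem_insert_iff, Set.mem_singleton_iff] at hx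
  have h5 : Real.sqrt 5 ^ 2 = 5 := Real.sq_sqrt (by norm_num)
  rcases hx with rfl | rfl
  · have : ((3 + Real.sqrt 5) / 2) ^ 2 - 3 * ((3 + Real.sqrt 5) / 2) + 1 = (0 : ℝ) := by nlinarith
    exact_mod_cast this
  · have : ((3 - Real.sqrt 5) / 2) ^ 2 - 3 * ((3 - Real.sqrt 5) / 2) + 1 = (0 : ℝ) := by nlinarith
    exact_mod_cast this

/-! ## §5 Near-misses / what would kill C1 (none closable in-kernel)

* `near_miss_artin` (not stated as a sorried theorem on purpose): `ExactSighting` ← strong Artin for one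
  Doud–Moore representation ← (Booker 2003) Artin holomorphy of its `L`-function. Open.
* Certified numerics (lead's line `Sketch` / card `artin-ansatz-joint-quasimode`): trial vector = the
  Artin `q`-expansion truncated at `M ≈ 2·10⁴` terms, joint `{Δ, T_p}` quasimode boxes (BSV 2006
  Lemma 3.2 / Child 2022 Thm 1 at `N = 1951`) ⇒ a `WindowSighting` as an Arb certificate — verdict
  class `computation`; it refutes C1 on the ledger but yields no term of type `¬ QuarterFingerprintDeficit`.
* Targets: the lead's HANDOFF lists no stuck stubs yet (payload `stuck_stubs = []`); the abstract stubs
  of `Sketch` (`weighted_pigeonhole` proved; `joint_quasimode_pigeonhole`,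
  `joint_eigenvector_meets_basis`) are finite-dimensional linear algebra and TRUE — nothing to break.
-/

end Summit.Langlands.Langlands.Cruxes.QuarterFingerprintDeficit.Disproof

end
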